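import Literature.NumberTheory.Sieve.IwaniecAlmostPrimesHooley
import Literature.NumberTheory.LFunctions.KloostermanWeilPrimeProofs
import HarnessLib

/-!
# Iwaniec (1978), Lemma 6 (Hooley's bound for incomplete Kloosterman sums) — DISCHARGED

H. Iwaniec, *Almost-primes represented by quadratic polynomials*, Invent. Math. **47** (1978)
171–188, Lemma 6 (p. 178) [cite: IwaniecInventiones1978, Lemma 6] = C. Hooley, Acta Math. **117**
(1967), Lemma 3: for integers `h`, `s ≥ 1`, `0 < r₂ − r₁ < 2s`, `λ` and a modulus `Λ ≥ 1`,
`∑_{r₁ < r < r₂, (r,s)=1, r ≡ λ (mod Λ)} e(h r̄ / s) ≪_ε s^{1/2+ε} (h, s)^{1/2}` — the named fact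
`Literature.NumberTheory.Sieve.Iwaniec1978.lemma6_hooley` of `IwaniecAlmostPrimes.lean`
("a consequence of A. Weil's estimate for Kloosterman sums", p. 178).

This file closes it unconditionally: `lemma6_hooley_holds`, combining

* `lemma6_hooley_of_weil_prime` (`IwaniecAlmostPrimesHooley.lean`, PROVED: completion of the
  incomplete sum + Weil's bound (2.25) for every modulus, itself reduced to the prime case in
  `Literature.NumberTheory.LFunctions.weil_kloosterman_bound_of_prime`), with
* `Literature.NumberTheory.LFunctions.weil_kloosterman_bound_prime_holds`
  (`KloostermanWeilPrimeProofs.lean`, PROVED: `|S(a, b; p)| ≤ 2√p` by the Stepanov–Schmidt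
  method, Schmidt LNM 536, Ch. II Theorem 2H).

So Iwaniec's Lemma 6 now rests on no named fact.

## References

* H. Iwaniec, Invent. Math. 47 (1978) 171–188, Lemma 6 (`IwaniecInventiones1978`).
* C. Hooley, *On the greatest prime factor of a quadratic polynomial*, Acta Math. 117 (1967)
  281–299, Lemma 3.
* W. M. Schmidt, *Equations over Finite Fields. An Elementary Approach*, LNM 536 (1976), Ch. II,
  Theorem 2H (`Schmidt1976`).
-/

noncomputable section

namespace Literature.NumberTheory.Sieve.Iwaniec1978

/-- **Iwaniec 1978, Lemma 6 (= Hooley 1967, Lemma 3) — PROVED**: for integers `h`, `s ≥ 1`,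
`0 < r₂ − r₁ < 2s`, `λ` and `Λ ≥ 1`,
`|∑_{r₁ < r < r₂, (r,s)=1, r ≡ λ (mod Λ)} e(h r̄ / s)| ≤ C(ε) s^{1/2+ε} (h, s)^{1/2}`
(discharges the named fact `lemma6_hooley`; Weil's bound enters through
`Literature.NumberTheory.LFunctions.weil_kloosterman_bound_prime_holds`).
[cite: IwaniecInventiones1978, Lemma 6] -/
theorem lemma6_hooley_holds : lemma6_hooley :=
  lemma6_hooley_of_weil_prime Literature.NumberTheory.LFunctions.weil_kloosterman_bound_prime_holds

end Literature.NumberTheory.Sieve.Iwaniec1978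

end
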